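/-
Copyright (c) 2026 the pub-hodgecm-mathlib formalisation cell (harness21).  Prover seat hodgecm-mathlib-K2Liu-p14 (g3), Track B «K2-LIT»,
#184♮ = hLiu418 = `stmt-HodgeConjecture-24832`; Road I v3, S5-F3 lineage ∕ I4-conv (F′-fact), FILE D part 2: the Euler product with a FINITE EXCEPTIONAL SET of local factors.
-/
import Summits.HodgeConjecture.HodgeConjecture.Theorems.K2LiuKlingenInnerSectionEuler   -- ★ FILE D (+ ★ Φ3c §1, ★ Tate 3.3.1 `tendsto_prod_integral_of_forall_rpBox`, ★ `eq_rpMeasure`)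
import HarnessLib

/-!
# Crux `HLiu418`, I4-conv (F′-fact), FILE D part 2 — `K2LiuKlingenInnerSectionEulerOff`: THE EULER PRODUCT ALONG A SPLITTING WHEN THE LOCAL FACTORS ARE `≡ 1` ON `K_i`
# ONLY OFF A FINITE EXCEPTIONAL SET `S₀` — `∫_Q F dμ_Q = (∫ g dμ) · ∏'_i ∫ φ_i dν_i`, same measure `μ ⊗ ∏'(ν_i; K_i)`

Cell `hodgecm-mathlib`, crux item hLiu418 = `stmt-HodgeConjecture-24832`; squad K2 ∕ K2Liu; LEAD F0P6-plan (g14) BATCH #36; prover K2Liu-p14 (g3).  THEOREMS ONLY (no `def`,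
no instance, no notation, no named-fact hypothesis, no `sorry`); lane `--supports stmt-HodgeConjecture-24832 --as helper` (count-neutral).

WHY.  ★ FILE D ∕ ★ Φ3c §1 ∕ ★ D0∘D `K2LiuKlingenFibreEulerProduct.exists_coord_integral_eq_mul_tprod` ask the local factor `φ_i` to be `≡ 1` on `K_i` for EVERY index `i`
(Tate's normalisation with empty exceptional set).  In the Euler factorisation of the inner section of term 2 (FILE E), the local integrand at `v ∉ T′` is
`d ↦ Λ^{(2)}_{s,v}(Ψ_v(ξ_v · n_{Q,v}(θ_v d) · m_{Q,v}(1, y_v)) · h_v)`, which is `≡ 1` on `𝒪_v³` only where `y_v ∈ U(J₂)(𝒪_v)` — i.e. off the finite, `y`-DEPENDENT set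
`S₀(y) = {v ∉ T′ : y_v ∉ U(J₂)(𝒪_v)}` — while the splitting and the factorizable shape must be those of the FIXED `T′` (★ #31s `IsFactorizableOff T′`).  Tate's theorem
allows exactly this (★ `tendsto_prod_integral_of_forall_rpBox` carries an exceptional set `S₀`); this file threads it through FILE D's heads, the measure staying
`μ ⊗ ∏'(ν_i; K_i)` with EMPTY level since `ν_i(K_i) = 1` for all `i` (`rpMeasure_empty_eq`: ★ `eq_rpMeasure`).
* `rpMeasure_empty_eq` (`∏'(ν; K)_∅ = ∏'(ν; K)_{S₀}` when `ν_i(K_i) = 1` for all `i`), `finprod_eq_prod_of_mem_rpBox_off`,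
  **`hasProd_integral_of_integrable_finprod_off`** (Tate 3.3.1 with exceptional set), **`integral_mul_finprod_eq_mul_tprod_off`** (★ Φ3c §1's head with exceptional set),
  **`integral_eq_mul_tprod_of_map_eq_off`**, **`hasProd_integral_of_map_eq_off`** (★ FILE D's heads with exceptional set).
[CasselsFrohlichANT1967, Ch. XV (Tate) §3.3 Thm. 3.3.1], [BorelJacquet1979, §4.1].
HONEST LABEL.  Count-neutral helper, closes no socket: `HC_CM` is proved only modulo the 7 printed citations (2 remaining named inputs: hLiu418 =
`stmt-HodgeConjecture-24832`, h413 = `stmt-HodgeConjecture-24833`) until rung 0 closes.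
-/

set_option autoImplicit false
set_option linter.dupNamespace false -- the mandated namespace repeats `HodgeConjecture.HodgeConjecture`

noncomputable section

open scoped RestrictedProduct ENNReal NNReal Topology
open MeasureTheory Measure Filter Set

namespace Summit.HodgeConjecture.HodgeConjecture.Cruxes.HLiu418.K2LiuKlingenInnerSectionEulerOff

open Literature.MeasureTheory.RestrictedProduct
open Summit.HodgeConjecture.HodgeConjecture.Cruxes.HLiu418.K2LiuSiegelUnipotentEulerProduct (integrable_finprod_of_integrable_mul)
open Summit.HodgeConjecture.HodgeConjecture.Cruxes.HLiu418.K2LiuKlingenInnerSectionEuler (integrable_comp_symm_of_map_eq integral_eq_integral_comp_symm_of_map_eq)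

variable {Q : Type} [MeasurableSpace Q] {X : Type} [MeasurableSpace X]
  {ι : Type} {G : ι → Type} [∀ i, MeasurableSpace (G i)] [Countable ι]
  (K : ∀ i, Set (G i)) (ν : ∀ i, Measure (G i)) [∀ i, SigmaFinite (ν i)]

/-- **the restricted product measure does not see the level when `ν_i(K_i) = 1` for all `i`**: `∏'(ν; K)_∅ = ∏'(ν; K)_{S₀}` (★ `eq_rpMeasure`: both have the product
restrictions to every cylinder `A_S`, `S ⊇ S₀`). [cite: CasselsFrohlichANT1967, Ch. XV (Tate) §3.3 Thm. 3.3.1] -/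
theorem rpMeasure_empty_eq (hKne : ∀ i, (K i).Nonempty) (hKm : ∀ i, MeasurableSet (K i)) (hK1 : ∀ i, ν i (K i) = 1) (S₀ : Finset ι) :
    rpMeasure K ν ∅ = rpMeasure K ν S₀ :=
  eq_rpMeasure K ν hKne hKm (S₀ := S₀) (fun i _ => hK1 i) _ fun _ _ =>
    rpMeasure_restrict_rpBox K ν hKne hKm (S₀ := ∅) (fun i _ => hK1 i) (Finset.empty_subset _)

omit [∀ i, MeasurableSpace (G i)] [Countable ι] [∀ i, SigmaFinite (ν i)] in
/-- on the cylinder `A_S`, `S ⊇ S₀`, a restricted tensor product whose factors are `≡ 1` on `K_i` OFF `S₀` is the finite product over `S`.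
[cite: CasselsFrohlichANT1967, Ch. XV (Tate) §3.3] -/
theorem finprod_eq_prod_of_mem_rpBox_off {R : Type} [CommMonoid R] (φ : ∀ i, G i → R) (S₀ : Finset ι) (hφK : ∀ i, i ∉ S₀ → ∀ k ∈ K i, φ i k = 1)
    {S : Finset ι} (hS : S₀ ⊆ S) {y : Πʳ i, [G i, K i]} (hy : y ∈ rpBox K S) :
    ∏ᶠ i, φ i (y i) = ∏ i ∈ S, φ i (y i) := by
  refine finprod_eq_prod_of_mulSupport_subset _ fun i hi => ?_
  rw [Finset.mem_coe]
  by_contra hiS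
  exact hi (hφK i (fun h => hiS (hS h)) _ (hy i hiS))

/-- **Tate's Theorem 3.3.1 with a finite exceptional set, `HasProd` form**: if `φ_i ≡ 1` on `K_i` for `i ∉ S₀` (`S₀` finite), `ν_i(K_i) = 1` for all `i`, and
`y ↦ ∏ᶠ_i φ_i(y_i)` is `∏'(ν; K)`-integrable, then `∏_i ∫ φ_i dν_i` CONVERGES to its integral (as a `HasProd` over all finite index sets).
[cite: CasselsFrohlichANT1967, Ch. XV (Tate) §3.3 Thm. 3.3.1] -/
theorem hasProd_integral_of_integrable_finprod_off (hKne : ∀ i, (K i).Nonempty) (hKm : ∀ i, MeasurableSet (K i)) (hK1 : ∀ i, ν i (K i) = 1)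
    (φ : ∀ i, G i → ℂ) (S₀ : Finset ι) (hφK : ∀ i, i ∉ S₀ → ∀ k ∈ K i, φ i k = 1)
    (hΦ : Integrable (fun y : Πʳ i, [G i, K i] => ∏ᶠ i, φ i (y i)) (rpMeasure K ν ∅)) :
    HasProd (fun i => ∫ y, φ i y ∂(ν i)) (∫ y, ∏ᶠ i, φ i (y i) ∂(rpMeasure K ν ∅)) := by
  rw [rpMeasure_empty_eq K ν hKne hKm hK1 S₀] at hΦ ⊢
  exact tendsto_prod_integral_of_forall_rpBox K ν hKne hKm (S₀ := S₀) (fun i _ => hK1 i) φ _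
    (fun T hT _ hy => finprod_eq_prod_of_mem_rpBox_off K φ S₀ hφK hT hy) hΦ

/-- **THE EULER PRODUCT OF A RESTRICTED TENSOR PRODUCT with a finite exceptional set** (★ Φ3c §1 `integral_mul_finprod_eq_mul_tprod`, `hφK` only off `S₀`):
`∫ g(x)·∏ᶠ_i φ_i(y_i) d(μ ⊗ ∏'ν) = (∫ g dμ) · ∏'_i ∫ φ_i dν_i` for `g ⊗ (∏ᶠ φ_i)` integrable. [cite: CasselsFrohlichANT1967, Ch. XV (Tate) §3.3 Thm. 3.3.1] -/
theorem integral_mul_finprod_eq_mul_tprod_off {X : Type} [MeasurableSpace X] (μ : Measure X) [SFinite μ]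
    (hKne : ∀ i, (K i).Nonempty) (hKm : ∀ i, MeasurableSet (K i)) (hK1 : ∀ i, ν i (K i) = 1)
    (g : X → ℂ) (φ : ∀ i, G i → ℂ) (S₀ : Finset ι) (hφK : ∀ i, i ∉ S₀ → ∀ k ∈ K i, φ i k = 1)
    (hint : Integrable (fun z : X × (Πʳ i, [G i, K i]) => g z.1 * ∏ᶠ i, φ i (z.2 i)) (μ.prod (rpMeasure K ν ∅))) :
    ∫ z, g z.1 * ∏ᶠ i, φ i (z.2 i) ∂(μ.prod (rpMeasure K ν ∅)) = (∫ x, g x ∂μ) * ∏' i, ∫ y, φ i y ∂(ν i) := by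
  haveI : SigmaFinite (rpMeasure K ν ∅) := sigmaFinite_rpMeasure _ _ hKm (S₀ := ∅) (fun i _ => hK1 i)
  rw [integral_prod_mul g (fun y : Πʳ i, [G i, K i] => ∏ᶠ i, φ i (y i))]
  by_cases hg : g =ᵐ[μ] 0
  · rw [integral_eq_zero_of_ae hg, zero_mul, zero_mul]
  · rw [(hasProd_integral_of_integrable_finprod_off K ν hKne hKm hK1 φ S₀ hφK
      (integrable_finprod_of_integrable_mul K ν μ hKm hK1 g φ hint hg)).tprod_eq]

/-- **★ FILE D's head with a finite exceptional set**: along a measurable splitting `E : Q ≃ᵐ X × Πʳ i, [G i, K i]` with `μ_Q ∘ E⁻¹ = μ ⊗ ∏'(ν; K)`, an integrable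
`F` of shape `F(E⁻¹(x,y)) = g(x) · ∏ᶠ_i φ_i(y_i)` with `φ_i ≡ 1` on `K_i` OFF `S₀` satisfies `∫_Q F dμ_Q = (∫ g dμ) · ∏'_i ∫ φ_i dν_i` (and the tensor is integrable).
[cite: CasselsFrohlichANT1967, Ch. XV (Tate) §3.3 Thm. 3.3.1] [cite: BorelJacquet1979, §4.1] -/
theorem integral_eq_mul_tprod_of_map_eq_off (μQ : Measure Q) (μ : Measure X) [SFinite μ]
    (hKne : ∀ i, (K i).Nonempty) (hKm : ∀ i, MeasurableSet (K i)) (hK1 : ∀ i, ν i (K i) = 1)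
    (E : Q ≃ᵐ X × (Πʳ i, [G i, K i])) (hmap : Measure.map E μQ = μ.prod (rpMeasure K ν ∅))
    {F : Q → ℂ} (hFi : Integrable F μQ) (g : X → ℂ) (φ : ∀ i, G i → ℂ) (S₀ : Finset ι) (hφK : ∀ i, i ∉ S₀ → ∀ k ∈ K i, φ i k = 1)
    (hF : ∀ (x : X) (y : Πʳ i, [G i, K i]), F (E.symm (x, y)) = g x * ∏ᶠ i, φ i (y i)) :
    Integrable (fun z : X × (Πʳ i, [G i, K i]) => g z.1 * ∏ᶠ i, φ i (z.2 i)) (μ.prod (rpMeasure K ν ∅)) ∧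
      ∫ q, F q ∂μQ = (∫ x, g x ∂μ) * ∏' i, ∫ y, φ i y ∂(ν i) := by
  have hfun : (fun z : X × (Πʳ i, [G i, K i]) => F (E.symm z)) = fun z => g z.1 * ∏ᶠ i, φ i (z.2 i) := by
    funext z
    exact hF z.1 z.2
  have hint : Integrable (fun z : X × (Πʳ i, [G i, K i]) => g z.1 * ∏ᶠ i, φ i (z.2 i)) (μ.prod (rpMeasure K ν ∅)) := by
    rw [← hfun]
    exact (integrable_comp_symm_of_map_eq K μQ _ E hmap).2 hFi
  refine ⟨hint, ?_⟩
  rw [integral_eq_integral_comp_symm_of_map_eq K μQ _ E hmap F, hfun]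
  exact integral_mul_finprod_eq_mul_tprod_off K ν μ hKne hKm hK1 g φ S₀ hφK hint

/-- **convergence with a finite exceptional set**: in the situation of `integral_eq_mul_tprod_of_map_eq_off`, if `g` is not a.e. zero then the Euler product
`∏_i ∫ φ_i dν_i` converges (`HasProd`) to `∫ ∏ᶠ φ d∏'ν`. [cite: CasselsFrohlichANT1967, Ch. XV (Tate) §3.3 Thm. 3.3.1] -/
theorem hasProd_integral_of_map_eq_off (μQ : Measure Q) (μ : Measure X) [SFinite μ]
    (hKne : ∀ i, (K i).Nonempty) (hKm : ∀ i, MeasurableSet (K i)) (hK1 : ∀ i, ν i (K i) = 1)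
    (E : Q ≃ᵐ X × (Πʳ i, [G i, K i])) (hmap : Measure.map E μQ = μ.prod (rpMeasure K ν ∅))
    {F : Q → ℂ} (hFi : Integrable F μQ) (g : X → ℂ) (hg : ¬ g =ᵐ[μ] 0) (φ : ∀ i, G i → ℂ) (S₀ : Finset ι)
    (hφK : ∀ i, i ∉ S₀ → ∀ k ∈ K i, φ i k = 1)
    (hF : ∀ (x : X) (y : Πʳ i, [G i, K i]), F (E.symm (x, y)) = g x * ∏ᶠ i, φ i (y i)) :
    Integrable (fun y : Πʳ i, [G i, K i] => ∏ᶠ i, φ i (y i)) (rpMeasure K ν ∅) ∧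
      HasProd (fun i => ∫ y, φ i y ∂(ν i)) (∫ y, ∏ᶠ i, φ i (y i) ∂(rpMeasure K ν ∅)) := by
  have hint := (integral_eq_mul_tprod_of_map_eq_off K ν μQ μ hKne hKm hK1 E hmap hFi g φ S₀ hφK hF).1
  have hΦ := integrable_finprod_of_integrable_mul K ν μ hKm hK1 g φ hint hg
  exact ⟨hΦ, hasProd_integral_of_integrable_finprod_off K ν hKne hKm hK1 φ S₀ hφK hΦ⟩

end Summit.HodgeConjecture.HodgeConjecture.Cruxes.HLiu418.K2LiuKlingenInnerSectionEulerOff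

end
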